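import Literature.NumberTheory.DiophantineGeometry.CongruenceLattice
import HarnessLib

/-!
# Primitive points of a congruence lattice in a box (the "basic geometry of numbers" count)

For `D ≥ 1` and integers `v₁, v₂` with `gcd(v₁, v₂, D) = 1`, the lattice
`Λ = {(w₁, w₂) ∈ ℤ² : v₁ w₁ + v₂ w₂ ≡ 0 (mod D)}` (index `D` in `ℤ²`) satisfies the uniform bound
`#{(w₁, w₂) ∈ Λ : |w₁| ≤ N₁, |w₂| ≤ N₂, gcd(w₁, w₂) = 1} ≤ 2 + 28 N₁ N₂ / D`
(`card_box_filter_coprime_congr_le`, `card_coprime_congr_box_le`; lattice facts in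
`Literature.NumberTheory.DiophantineGeometry.CongruenceLattice`). Projecting a primitive solution
`(x, y, z)` of `a₁ x + a₂ y + a₃ z = 0` (`gcd(a₁, a₂, a₃) = 1`, `a₃ ≠ 0`, `gcd(x, y) = 1`) to
`(x, y)` gives such a point with `D = |a₃|`, so this is the bound "by basic geometry of numbers,
the number of primitive solutions is `≪ 1 + X₁Y₁Z₁ / max(|aᵢ|Xᵢ)`" of the proofs of
[Bernert2025, Prop. 2] and [BernertEtAl2024, Prop. 3.2 (arXiv v1)] (there via Heath-Brown,
Math. Z. 187 (1984)) in the case where the maximum is `|a₃| Z₁`; it is the geometry-of-numbers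
input of the bounds for `N_λ(X)` in `AbcExceptionalSetBounds`.

## Proof (elementary, no Minkowski theory)

Work in `S = Λ ∩ [-N₁, N₁] × [-N₂, N₂]` with `N₁, N₂ ≥ 1` (else only `(0, ±1)` or `(±1, 0)` are
coprime). `Λ` is a group and `det(p, q) ≡ 0 (mod D)` on it (cofactors and a Bézout relation). Let
`b ∈ S ∖ {0}` minimise the gauge `φ(w) = max(|w₁| N₂, |w₂| N₁)`, `1 ≤ m := φ(b) ≤ N₁N₂`; by
minimality every `r ∈ Λ` parallel to `b` is an integer multiple of `b`. Fibre `S` over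
`k = det(b, p) ∈ Dℤ ∩ [-2m, 2m]` (`≤ 4m/D + 1` fibres); two points of a fibre differ by `t b` with
`|t| m ≤ 2N₁N₂` (`≤ 4N₁N₂/m + 1` points each). If some `det(b, p) ≠ 0` then `D ≤ 2m` and
`#S ≤ (4m/D + 1)(4N₁N₂/m + 1) ≤ 28 N₁N₂/D + 1`; otherwise every `p ∈ S` is `t b` and
`gcd(p₁, p₂) = 1` forces `t = ±1`.

## References

* [Bernert2025] C. Bernert, *The exceptional set in the abc conjecture*, arXiv:2506.13364 (2025),
  proof of Proposition 2.
* [BernertEtAl2024] C. Bernert, T. Browning, J. D. Lichtman, J. Teräväinen, *Bounds on the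
  exceptional set in the abc conjecture*, arXiv:2410.12234, proof of Proposition 3.2 (v1).
-/

noncomputable section

open Finset

namespace Literature.NumberTheory.DiophantineGeometry


open CongruenceLattice

/-! ### The count -/

/-- **Primitive points of a congruence lattice in a box.** Let `D ≥ 1` and `v₁, v₂ ∈ ℤ` with
`gcd(v₁, v₂, D) = 1`. Then for all `N₁, N₂ ∈ ℕ`,
`#{(w₁, w₂) ∈ ℤ² : |w₁| ≤ N₁, |w₂| ≤ N₂, gcd(w₁, w₂) = 1, D ∣ v₁w₁ + v₂w₂} ≤ 2 + 28 N₁N₂/D`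
(`Finset` form, the box being `Icc (-N₁) N₁ ×ˢ Icc (-N₂) N₂`; the `Set.ncard` form is
`card_coprime_congr_box_le`). This is the "basic geometry of numbers" bound `≪ 1 + X₁Y₁Z₁/max(|aᵢ|Xᵢ)` for the primitive
solutions of `a₁x + a₂y + a₃z = 0` in a box, in the form used in [Bernert2025, proof of Prop. 2]
(project along `z`; `D = |a₃|`); proved here by an elementary fibring argument over the lines
parallel to a gauge-minimal vector of the lattice (see the module docstring). [folklore] -/
theorem card_box_filter_coprime_congr_le {D : ℕ} (hD : 0 < D) {v₁ v₂ : ℤ}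
    (hv : Nat.Coprime (Int.gcd v₁ v₂) D) (N₁ N₂ : ℕ) :
    ((((Icc (-(N₁ : ℤ)) N₁ ×ˢ Icc (-(N₂ : ℤ)) N₂).filter
        (fun w => Int.gcd w.1 w.2 = 1 ∧ (D : ℤ) ∣ v₁ * w.1 + v₂ * w.2)).card : ℕ) : ℝ) ≤
      2 + 28 * (N₁ : ℝ) * N₂ / D := by
  classical
  -- the box `R`, the lattice points `S` in it, and the coprime ones `T`
  set R : Finset (ℤ × ℤ) := Icc (-(N₁ : ℤ)) N₁ ×ˢ Icc (-(N₂ : ℤ)) N₂ with hR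
  set S : Finset (ℤ × ℤ) := R.filter (fun w => InL D v₁ v₂ w) with hS
  set T : Finset (ℤ × ℤ) := S.filter (fun w => Int.gcd w.1 w.2 = 1) with hT
  have hmemR : ∀ w : ℤ × ℤ, w ∈ R ↔ |w.1| ≤ N₁ ∧ |w.2| ≤ N₂ := by
    intro w
    simp only [hR, mem_product, mem_Icc, abs_le]
  have hmemS : ∀ w : ℤ × ℤ, w ∈ S ↔ (|w.1| ≤ N₁ ∧ |w.2| ≤ N₂) ∧ InL D v₁ v₂ w := by
    intro w; rw [hS, mem_filter, hmemR]
  have hmemT : ∀ w : ℤ × ℤ, w ∈ T ↔ ((|w.1| ≤ N₁ ∧ |w.2| ≤ N₂) ∧ InL D v₁ v₂ w) ∧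
      Int.gcd w.1 w.2 = 1 := by
    intro w; rw [hT, mem_filter, hmemS]
  have hTeq : R.filter (fun w => Int.gcd w.1 w.2 = 1 ∧ (D : ℤ) ∣ v₁ * w.1 + v₂ * w.2) = T := by
    ext w
    rw [mem_filter, hmemT, hmemR, InL]
    tauto
  rw [hTeq]
  have hD' : (0 : ℝ) < D := by exact_mod_cast hD
  have hbound_nonneg : (0 : ℝ) ≤ 28 * (N₁ : ℝ) * N₂ / D := by positivity
  -- points of `T` are nonzero
  have hT0 : ∀ w ∈ T, w ≠ 0 := by
    intro w hw h0
    have h1 := ((hmemT w).mp hw).2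
    rw [h0] at h1
    simp at h1
  /- degenerate boxes: `N₁ = 0` or `N₂ = 0` -/
  by_cases hN : N₁ = 0 ∨ N₂ = 0
  · have hT2 : T.card ≤ 2 := by
      rcases hN with h0 | h0
      · have hsub : T ⊆ {((0 : ℤ), (1 : ℤ)), ((0 : ℤ), (-1 : ℤ))} := by
          intro w hw
          obtain ⟨⟨⟨h1, -⟩, -⟩, hg⟩ := (hmemT w).mp hw
          rw [h0, Nat.cast_zero, abs_nonpos_iff] at h1
          rw [h1, Int.gcd_zero_left] at hg
          have h2 : w.2 = 1 ∨ w.2 = -1 := Int.natAbs_eq_natAbs_iff.mp (by simpa using hg)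
          rw [mem_insert, mem_singleton]
          rcases h2 with h2 | h2
          · exact Or.inl (Prod.ext h1 h2)
          · exact Or.inr (Prod.ext h1 h2)
        exact (card_le_card hsub).trans (card_insert_le _ _)
      · have hsub : T ⊆ {((1 : ℤ), (0 : ℤ)), ((-1 : ℤ), (0 : ℤ))} := by
          intro w hw
          obtain ⟨⟨⟨-, h1⟩, -⟩, hg⟩ := (hmemT w).mp hw
          rw [h0, Nat.cast_zero, abs_nonpos_iff] at h1
          rw [h1, Int.gcd_zero_right] at hg
          have h2 : w.1 = 1 ∨ w.1 = -1 := Int.natAbs_eq_natAbs_iff.mp (by simpa using hg)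
          rw [mem_insert, mem_singleton]
          rcases h2 with h2 | h2
          · exact Or.inl (Prod.ext h2 h1)
          · exact Or.inr (Prod.ext h2 h1)
        exact (card_le_card hsub).trans (card_insert_le _ _)
    have : (T.card : ℝ) ≤ 2 := by exact_mod_cast hT2
    linarith
  push Not at hN
  obtain ⟨hN₁, hN₂⟩ := hN
  /- the empty case -/
  rcases T.eq_empty_or_nonempty with hTe | hTne
  · rw [hTe, card_empty, Nat.cast_zero]; linarith
  /- a gauge-minimal nonzero vector `b` of `S` -/
  set S' : Finset (ℤ × ℤ) := S.filter (fun w => w ≠ 0) with hS'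
  have hTS' : T ⊆ S' := by
    intro w hw
    rw [hS', mem_filter]
    exact ⟨(mem_filter.mp (by rw [hT] at hw; exact hw)).1, hT0 w hw⟩
  have hS'ne : S'.Nonempty := hTne.mono hTS'
  obtain ⟨b, hbS', hbmin⟩ := S'.exists_min_image (gauge N₁ N₂) hS'ne
  obtain ⟨hbS, hb0⟩ := mem_filter.mp hbS'
  obtain ⟨⟨hb1, hb2⟩, hbL⟩ := (hmemS b).mp hbS
  set m : ℕ := gauge N₁ N₂ b with hm
  -- `|b₁| N₂ ≤ m`, `|b₂| N₁ ≤ m`, `1 ≤ m ≤ N₁ N₂`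
  have hb1m : b.1.natAbs * N₂ ≤ m := le_max_left _ _
  have hb2m : b.2.natAbs * N₁ ≤ m := le_max_right _ _
  have hb1N : b.1.natAbs ≤ N₁ := by
    have := hb1; rw [Int.abs_eq_natAbs] at this; exact_mod_cast this
  have hb2N : b.2.natAbs ≤ N₂ := by
    have := hb2; rw [Int.abs_eq_natAbs] at this; exact_mod_cast this
  have hmN : m ≤ N₁ * N₂ := by
    refine max_le ?_ ?_
    · exact Nat.mul_le_mul_right _ hb1N
    · rw [mul_comm]; exact Nat.mul_le_mul_left _ hb2N
  have hm1 : 1 ≤ m := by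
    by_contra hlt
    push Not at hlt
    have h0 : m = 0 := by omega
    have h1 : b.1.natAbs * N₂ = 0 := by have := hb1m; omega
    have h2 : b.2.natAbs * N₁ = 0 := by have := hb2m; omega
    rcases mul_eq_zero.mp h1 with h1 | h1
    · rcases mul_eq_zero.mp h2 with h2 | h2
      · exact hb0 (Prod.ext (Int.natAbs_eq_zero.mp h1) (Int.natAbs_eq_zero.mp h2))
      · exact hN₁ h2
    · exact hN₂ h1
  have hm0 : 0 < m := hm1
  /- minimality: a vector of `Λ` parallel to `b` is an integer multiple of `b` -/
  have hpar : ∀ r : ℤ × ℤ, InL D v₁ v₂ r → det2 b r = 0 →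
      ∃ q : ℤ, r.1 = q * b.1 ∧ r.2 = q * b.2 := by
    intro r hr hdet
    obtain ⟨t, ht1, ht2⟩ := exists_gcd_mul_eq_of_det2_eq_zero hb0 hdet
    set g : ℤ := (Int.gcd b.1 b.2 : ℤ) with hg
    have hgpos : 0 < g := by
      rw [hg]; exact_mod_cast Int.gcd_pos_iff.mpr (by
        by_contra hcon; push Not at hcon; exact hb0 (Prod.ext hcon.1 hcon.2))
    set q : ℤ := t / g with hq
    set s : ℤ := t % g with hs
    have hts : g * q + s = t := Int.mul_ediv_add_emod t g
    have hs0 : 0 ≤ s := Int.emod_nonneg _ hgpos.ne'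
    have hsg : s < g := Int.emod_lt_of_pos _ hgpos
    -- `u = r - q b` satisfies `g u = s b`
    set u : ℤ × ℤ := (r.1 - q * b.1, r.2 - q * b.2) with hu
    have hgu1 : g * u.1 = s * b.1 := by
      simp only [hu]; linear_combination ht1 - b.1 * hts
    have hgu2 : g * u.2 = s * b.2 := by
      simp only [hu]; linear_combination ht2 - b.2 * hts
    rcases eq_or_lt_of_le hs0 with hs00 | hspos
    · -- `s = 0`: `u = 0`
      rw [← hs00, zero_mul] at hgu1 hgu2
      have hu1 : u.1 = 0 := (mul_eq_zero.mp hgu1).resolve_left hgpos.ne'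
      have hu2 : u.2 = 0 := (mul_eq_zero.mp hgu2).resolve_left hgpos.ne'
      simp only [hu] at hu1 hu2
      exact ⟨q, by linarith, by linarith⟩
    · -- `0 < s < g`: `u` is a shorter nonzero vector of `S`, contradiction
      exfalso
      have huL : InL D v₁ v₂ u := hr.sub_smul hbL q
      have habs1 : g * |u.1| = s * |b.1| := by
        rw [← abs_of_pos hgpos, ← abs_mul, hgu1, abs_mul, abs_of_pos hspos]
      have habs2 : g * |u.2| = s * |b.2| := by
        rw [← abs_of_pos hgpos, ← abs_mul, hgu2, abs_mul, abs_of_pos hspos]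
      have hule1 : |u.1| ≤ |b.1| := by nlinarith [abs_nonneg u.1, abs_nonneg b.1]
      have hule2 : |u.2| ≤ |b.2| := by nlinarith [abs_nonneg u.2, abs_nonneg b.2]
      have huR : |u.1| ≤ N₁ ∧ |u.2| ≤ N₂ := ⟨hule1.trans hb1, hule2.trans hb2⟩
      have hu0 : u ≠ 0 := by
        intro h0
        have h1 : u.1 = 0 ∧ u.2 = 0 := by rw [h0]; exact ⟨rfl, rfl⟩
        rw [h1.1, mul_zero] at hgu1
        rw [h1.2, mul_zero] at hgu2
        have hb1z : b.1 = 0 := (mul_eq_zero.mp hgu1.symm).resolve_left hspos.ne'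
        have hb2z : b.2 = 0 := (mul_eq_zero.mp hgu2.symm).resolve_left hspos.ne'
        exact hb0 (Prod.ext hb1z hb2z)
      have huS' : u ∈ S' := by
        rw [hS', mem_filter, hmemS]
        exact ⟨⟨huR, huL⟩, hu0⟩
      -- gauges: `g φ(u) = s φ(b) < g φ(b)`
      have hgg : (g.natAbs : ℕ) * gauge N₁ N₂ u = s.natAbs * gauge N₁ N₂ b := by
        rw [← gauge_mul, ← gauge_mul]
        simp only [hgu1, hgu2]
      have hlt : gauge N₁ N₂ u < gauge N₁ N₂ b := by
        have hsg' : s.natAbs < g.natAbs := by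
          have := Int.natAbs_lt_natAbs_of_nonneg_of_lt hs0 hsg; exact this
        have hgpos' : 0 < g.natAbs := Int.natAbs_pos.mpr hgpos.ne'
        by_contra hge
        push Not at hge
        have h1 : s.natAbs * gauge N₁ N₂ b < g.natAbs * gauge N₁ N₂ b :=
          Nat.mul_lt_mul_of_pos_right hsg' hm0
        have h2 : g.natAbs * gauge N₁ N₂ b ≤ g.natAbs * gauge N₁ N₂ u :=
          Nat.mul_le_mul_left _ hge
        omega
      exact absurd (hbmin u huS') (not_le.mpr hlt)
  /- fibres of `det(b, ·)` over `S` -/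
  set T₀ : ℕ := 2 * N₁ * N₂ / m with hT₀
  have hfib : ∀ k : ℤ, (S.filter (fun p => det2 b p = k)).card ≤ 2 * T₀ + 1 := by
    intro k
    rcases (S.filter (fun p => det2 b p = k)).eq_empty_or_nonempty with he | ⟨q, hq⟩
    · rw [he, card_empty]; exact Nat.zero_le _
    obtain ⟨hqS, hqk⟩ := mem_filter.mp hq
    obtain ⟨⟨hq1, hq2⟩, hqL⟩ := (hmemS q).mp hqS
    -- the parameter `t(p)` with `p - q = t b`
    let τ : ℤ × ℤ → ℤ := fun p => if b.1 ≠ 0 then (p.1 - q.1) / b.1 else (p.2 - q.2) / b.2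
    have hτ : ∀ p ∈ S.filter (fun p => det2 b p = k),
        p.1 - q.1 = τ p * b.1 ∧ p.2 - q.2 = τ p * b.2 ∧ (τ p).natAbs ≤ T₀ := by
      intro p hp
      obtain ⟨hpS, hpk⟩ := mem_filter.mp hp
      obtain ⟨⟨hp1, hp2⟩, hpL⟩ := (hmemS p).mp hpS
      have hrL : InL D v₁ v₂ (p.1 - 1 * q.1, p.2 - 1 * q.2) := hpL.sub_smul hqL 1
      simp only [one_mul] at hrL
      have hdet : det2 b (p.1 - q.1, p.2 - q.2) = 0 := by
        unfold det2 at hpk hqk ⊢; simp only; linear_combination hpk - hqk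
      obtain ⟨t, ht1, ht2⟩ := hpar _ hrL hdet
      simp only at ht1 ht2
      have hτt : τ p = t := by
        simp only [τ]
        split_ifs with hb1z
        · rw [ht1, Int.mul_ediv_cancel _ hb1z]
        · push Not at hb1z
          have hb2z : b.2 ≠ 0 := fun h2 => hb0 (Prod.ext hb1z h2)
          rw [ht2, Int.mul_ediv_cancel _ hb2z]
      rw [hτt]
      refine ⟨ht1, ht2, ?_⟩
      -- `|t| m = φ(t b) = φ(p - q) ≤ 2 N₁ N₂`
      have hg1 : gauge N₁ N₂ (p.1 - q.1, p.2 - q.2) ≤ 2 * N₁ * N₂ := by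
        refine (gauge_sub_le N₁ N₂ p q).trans ?_
        have hgp : gauge N₁ N₂ p ≤ N₁ * N₂ := by
          refine max_le ?_ ?_
          · have : p.1.natAbs ≤ N₁ := by
              rw [Int.abs_eq_natAbs] at hp1; exact_mod_cast hp1
            exact Nat.mul_le_mul_right _ this
          · have : p.2.natAbs ≤ N₂ := by
              rw [Int.abs_eq_natAbs] at hp2; exact_mod_cast hp2
            rw [mul_comm]; exact Nat.mul_le_mul_left _ this
        have hgq : gauge N₁ N₂ q ≤ N₁ * N₂ := by
          refine max_le ?_ ?_
          · have : q.1.natAbs ≤ N₁ := by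
              rw [Int.abs_eq_natAbs] at hq1; exact_mod_cast hq1
            exact Nat.mul_le_mul_right _ this
          · have : q.2.natAbs ≤ N₂ := by
              rw [Int.abs_eq_natAbs] at hq2; exact_mod_cast hq2
            rw [mul_comm]; exact Nat.mul_le_mul_left _ this
        linarith
      have hg2 : gauge N₁ N₂ (p.1 - q.1, p.2 - q.2) = t.natAbs * m := by
        rw [hm, ← gauge_mul]; simp only [ht1, ht2]
      rw [hg2] at hg1
      rw [hT₀, Nat.le_div_iff_mul_le hm0]
      exact hg1
    refine (card_le_card_of_injOn (t := (Icc (-(T₀ : ℤ)) T₀ : Finset ℤ)) τ (fun p hp => ?_)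
      (fun p hp p' hp' h => ?_)).trans ?_
    · -- lands in `Icc (-T₀) T₀`
      have h3 := (hτ p hp).2.2
      rw [mem_coe, mem_Icc, ← abs_le, Int.abs_eq_natAbs]
      exact_mod_cast h3
    · obtain ⟨h1, h2, -⟩ := hτ p hp
      obtain ⟨h1', h2', -⟩ := hτ p' hp'
      have e : τ p = τ p' := h
      refine Prod.ext ?_ ?_
      · linear_combination h1 - h1' + b.1 * e
      · linear_combination h2 - h2' + b.2 * e
    · rw [Int.card_Icc]
      norm_num
      omega
  /- the values of `det(b, ·)` on `S` -/
  set K₀ : ℕ := 2 * m / D with hK₀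
  have hdetS : ∀ p ∈ S, (det2 b p).natAbs ≤ 2 * m ∧ (D : ℤ) ∣ det2 b p := by
    intro p hp
    obtain ⟨⟨hp1, hp2⟩, hpL⟩ := (hmemS p).mp hp
    refine ⟨?_, dvd_det2 hv hbL hpL⟩
    have hp1' : p.1.natAbs ≤ N₁ := by rw [Int.abs_eq_natAbs] at hp1; exact_mod_cast hp1
    have hp2' : p.2.natAbs ≤ N₂ := by rw [Int.abs_eq_natAbs] at hp2; exact_mod_cast hp2
    unfold det2
    calc (b.1 * p.2 - b.2 * p.1).natAbs ≤ (b.1 * p.2).natAbs + (b.2 * p.1).natAbs :=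
          Int.natAbs_sub_le _ _
      _ = b.1.natAbs * p.2.natAbs + b.2.natAbs * p.1.natAbs := by
          rw [Int.natAbs_mul, Int.natAbs_mul]
      _ ≤ b.1.natAbs * N₂ + b.2.natAbs * N₁ :=
          add_le_add (Nat.mul_le_mul_left _ hp2') (Nat.mul_le_mul_left _ hp1')
      _ ≤ m + m := add_le_add hb1m hb2m
      _ = 2 * m := by ring
  have himage : S.image (det2 b) ⊆ (Icc (-(K₀ : ℤ)) K₀).image (fun k' => (D : ℤ) * k') := by
    intro k hk
    obtain ⟨p, hp, rfl⟩ := mem_image.mp hk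
    obtain ⟨hle, ⟨k', hk'⟩⟩ := hdetS p hp
    refine mem_image.mpr ⟨k', ?_, hk'.symm⟩
    rw [mem_Icc, ← abs_le, Int.abs_eq_natAbs]
    have h1 : D * k'.natAbs ≤ 2 * m := by
      rw [hk', Int.natAbs_mul, Int.natAbs_natCast] at hle; exact hle
    have h2 : k'.natAbs ≤ K₀ := by
      rw [hK₀, Nat.le_div_iff_mul_le hD, mul_comm]; exact h1
    exact_mod_cast h2
  have hcardK : (S.image (det2 b)).card ≤ 2 * K₀ + 1 := by
    refine (card_le_card himage).trans (card_image_le.trans ?_)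
    rw [Int.card_Icc]; norm_num; omega
  /- `#S ≤ (2K₀ + 1)(2T₀ + 1)` -/
  have hScard : S.card ≤ (2 * K₀ + 1) * (2 * T₀ + 1) := by
    rw [card_eq_sum_card_image (det2 b) S]
    refine (sum_le_sum (fun k _ => hfib k)).trans ?_
    rw [sum_const, smul_eq_mul]
    exact Nat.mul_le_mul_right _ hcardK
  have hTcard : T.card ≤ S.card := card_le_card (filter_subset _ _)
  /- collinear or not -/
  by_cases hcol : ∀ p ∈ S, det2 b p = 0
  · -- every coprime point is `± b`
    have hsub : T ⊆ {b, (-b.1, -b.2)} := by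
      intro p hp
      obtain ⟨⟨-, hpL⟩, hg⟩ := (hmemT p).mp hp
      have hpS : p ∈ S := (mem_filter.mp (by rw [hT] at hp; exact hp)).1
      obtain ⟨t, ht1, ht2⟩ := hpar p hpL (hcol p hpS)
      have hgcd : Int.gcd p.1 p.2 = t.natAbs * Int.gcd b.1 b.2 := by
        rw [ht1, ht2, Int.gcd_mul_left]
      rw [hg] at hgcd
      have ht : t.natAbs = 1 := Nat.eq_one_of_mul_eq_one_right hgcd.symm
      rw [mem_insert, mem_singleton]
      rcases Int.natAbs_eq_natAbs_iff.mp (show t.natAbs = (1 : ℤ).natAbs by simpa using ht)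
        with h1 | h1
      · left; rw [h1, one_mul] at ht1; rw [h1, one_mul] at ht2; exact Prod.ext ht1 ht2
      · right; rw [h1] at ht1 ht2; exact Prod.ext (by simp [ht1]) (by simp [ht2])
    have hT2 : T.card ≤ 2 := (card_le_card hsub).trans (card_insert_le _ _)
    have : (T.card : ℝ) ≤ 2 := by exact_mod_cast hT2
    linarith
  · -- some `p ∈ S` has `det(b, p) ≠ 0`, so `D ≤ 2m`
    push Not at hcol
    obtain ⟨p, hpS, hp0⟩ := hcol
    obtain ⟨hle, hdvd⟩ := hdetS p hpS
    have hDm : D ≤ 2 * m := by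
      have h2 : (D : ℤ).natAbs ∣ (det2 b p).natAbs := Int.natAbs_dvd_natAbs.mpr hdvd
      rw [Int.natAbs_natCast] at h2
      exact (Nat.le_of_dvd (Int.natAbs_pos.mpr hp0) h2).trans hle
    -- real arithmetic
    have hm0' : (0 : ℝ) < m := by exact_mod_cast hm0
    have hK₀le : (K₀ : ℝ) ≤ 2 * m / D := by
      rw [hK₀, le_div_iff₀ hD']; exact_mod_cast Nat.div_mul_le_self (2 * m) D
    have hT₀le : (T₀ : ℝ) ≤ 2 * N₁ * N₂ / m := by
      rw [hT₀, le_div_iff₀ hm0']; exact_mod_cast Nat.div_mul_le_self (2 * N₁ * N₂) m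
    have hmN' : (m : ℝ) ≤ N₁ * N₂ := by exact_mod_cast hmN
    have hDm' : (D : ℝ) ≤ 2 * m := by exact_mod_cast hDm
    have h1 : (T.card : ℝ) ≤ (2 * K₀ + 1) * (2 * T₀ + 1) := by
      exact_mod_cast hTcard.trans hScard
    have h2 : (2 * (K₀ : ℝ) + 1) * (2 * T₀ + 1) ≤ (4 * m / D + 1) * (4 * N₁ * N₂ / m + 1) := by
      have hK' : 2 * (K₀ : ℝ) + 1 ≤ 4 * m / D + 1 := by
        have : 2 * (2 * (m : ℝ) / D) = 4 * m / D := by ring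
        linarith
      have hT' : 2 * (T₀ : ℝ) + 1 ≤ 4 * N₁ * N₂ / m + 1 := by
        have : 2 * (2 * (N₁ : ℝ) * N₂ / m) = 4 * N₁ * N₂ / m := by ring
        linarith
      exact mul_le_mul hK' hT' (by positivity) (by positivity)
    have h3 : (4 * (m : ℝ) / D + 1) * (4 * N₁ * N₂ / m + 1) =
        16 * N₁ * N₂ / D + 4 * m / D + 4 * N₁ * N₂ / m + 1 := by
      field_simp
      ring
    have h4 : 4 * (m : ℝ) / D ≤ 4 * N₁ * N₂ / D := by
      rw [div_le_div_iff_of_pos_right hD']; linarith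
    have h5 : 4 * (N₁ : ℝ) * N₂ / m ≤ 8 * N₁ * N₂ / D := by
      rw [div_le_div_iff₀ hm0' hD']
      have : 0 ≤ (N₁ : ℝ) * N₂ := by positivity
      nlinarith
    linarith [show 16 * (N₁ : ℝ) * N₂ / D + 4 * N₁ * N₂ / D + 8 * N₁ * N₂ / D =
        28 * N₁ * N₂ / D by ring]

/-- **Primitive points of a congruence lattice in a box**, `Set.ncard` form of
`card_box_filter_coprime_congr_le`: for `D ≥ 1` and `gcd(v₁, v₂, D) = 1`,
`#{(w₁, w₂) ∈ ℤ² : |w₁| ≤ N₁, |w₂| ≤ N₂, gcd(w₁, w₂) = 1, D ∣ v₁w₁ + v₂w₂} ≤ 2 + 28 N₁N₂/D`.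
[folklore] -/
theorem card_coprime_congr_box_le {D : ℕ} (hD : 0 < D) {v₁ v₂ : ℤ}
    (hv : Nat.Coprime (Int.gcd v₁ v₂) D) (N₁ N₂ : ℕ) :
    (({w : ℤ × ℤ | |w.1| ≤ N₁ ∧ |w.2| ≤ N₂ ∧ Int.gcd w.1 w.2 = 1 ∧
        (D : ℤ) ∣ v₁ * w.1 + v₂ * w.2}.ncard : ℕ) : ℝ) ≤ 2 + 28 * (N₁ : ℝ) * N₂ / D := by
  classical
  have hset : {w : ℤ × ℤ | |w.1| ≤ N₁ ∧ |w.2| ≤ N₂ ∧ Int.gcd w.1 w.2 = 1 ∧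
      (D : ℤ) ∣ v₁ * w.1 + v₂ * w.2} =
      ↑((Icc (-(N₁ : ℤ)) N₁ ×ˢ Icc (-(N₂ : ℤ)) N₂).filter
        (fun w => Int.gcd w.1 w.2 = 1 ∧ (D : ℤ) ∣ v₁ * w.1 + v₂ * w.2)) := by
    ext w
    simp only [Set.mem_setOf_eq, coe_filter, mem_product, mem_Icc, abs_le]
    tauto
  rw [hset, Set.ncard_coe_finset]
  convert card_box_filter_coprime_congr_le hD hv N₁ N₂ using 4

end Literature.NumberTheory.DiophantineGeometry
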